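import Summits.BirchSwinnertonDyer.BirchSwinnertonDyer.Theorems.Rank2ShaTierKit
import Summits.BirchSwinnertonDyer.Rank1Residual.GaloisImage.FrobeniusOrderWitness
import Literature.NumberTheory.EllipticCurves.Wuthrich2014.ThreeAdicImageSupersingularProofs
import HarnessLib

/-!
# BirchSwinnertonDyer — rank-2 `Ш[3^∞]` cell: the TIER KIT at `p = 3` (sub-tier G1-3, frame «kato-bound»)

HONEST FRAMING (cell `b2b-bsdr2sha`, run/shared/lean/b2b/bsd-rank2-sha/): per-pair certified
theorems «cited hypotheses ∧ certified computation ⇒ `Ш(E/ℚ)[p^∞]` finite of order `p^k`» for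
rank-2 curves at good ordinary primes; NO claim on BSD in rank `≥ 2`, no class-level theorem, every
published input is a NAMED HYPOTHESIS of the tree (nothing is asserted or minted here).

The base kit `Rank2ShaTierKit.lean` hard-wires `5 ≤ p` (Serre's Prop. 19 witnesses of `ρ̄_{E,p}` onto
need `p ≥ 5`). At `p = 3` (cell ruling (15)/(16): ceiling kato-bound, Skinner–Urban OFF) two things change:
(a) `ρ̄_{E,3}` onto is certified by the Frobenius ORDER witness of the sibling cell
(`Rank1Residual/GaloisImage/FrobeniusOrderWitness.lean`, `hasSurjectiveModNGaloisRep_of_intModel_of_irr_of_order`: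
one good `ℓ₁` with `X² − a_{ℓ₁}X + ℓ₁` irreducible mod `3` and one good `ℓ₂ ≡ 1 (mod 3)` with
`a_{ℓ₂} ≡ 2 (mod 3)`, `9 ∤ #Ẽ(𝔽_{ℓ₂})` — Serre 1972 Prop. 15); (b) Kato's (12.5.2) («`ρ_{E,3^∞}` onto»)
does not follow from surj(3) in general (Elkies) but DOES at a prime `3` of good reduction — Wuthrich 2014
Lemma 20, DISCHARGED in the tree (`Wuthrich2014.lemma20_surjective_threeAdic_of_semistable_holds`) — so the
row theorem is the tree's `card_shaPrimary_le_of_kato_certificate_three` with that fact supplied.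

* `SurjWitness.check₃` — kernel test of the two Frobenius witnesses at `p = 3`, read in the slots
  `(l₁, sq₁, n₁)` = `ℓ₁` and `(l₂, sq₂, n₂)` = `ℓ₂` of the row's `SurjWitness` (other slots ignored);
  `SurjWitness.surj_three_of_check₃` ⇒ `ρ̄_{E,3}` onto;
* `ShaRow.check₃` — the base test with `p = 3` (good ORDINARY at `3`: `3 ∤ Δ`, `#Ẽ(𝔽₃) = 4 − a₃`, `3 ∤ a₃`;
  minimal model; exact Tamagawa certificate); soundness `p_eq_three`, `isElliptic_and_isGloballyMinimal₃`,
  `isOrdinaryAt₃`, `reductionPointCount_eq_and_tamagawaProduct_eq₃`; `ShaRow.checkK₃ := check₃ ∧ sw.check₃`;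
* `ShaRow.kato₃` (`ord_3 #Ш(E/ℚ)[3^∞] ≤ R.k`), `ShaRow.kato₃_eq_one` (`R.k ≤ 0 ⇒ Ш(E/ℚ)[3^∞] = 0`);
* READERS `ShaRow.booked_katoOne₃` (certificate `R.checkK₃ = true ∧ R.k ≤ 0 ∧ 2 ≤ rank`) and
  `ShaRow.booked_katoLe₃` (`R.checkK₃ = true ∧ 2 ≤ rank`), binders exactly the kato tier's: `hS` (PRS, odd `p`),
  `hK` (Kato 17.4 for every cyclotomic datum), the newform, `[T²]L_3 ≠ 0`, `ord_3 [T²]L_3 = R.a`, THE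
  canonical `3`-adic height datum with `ord_3 Reg_3 = R.b`.

References: K. Kato, Astérisque 295 (2004), Thm. 17.4 and (12.5.2) [Kato2004Asterisque]; C. Wuthrich,
Doc. Math. 19 (2014), Lemma 20 [Wuthrich2014]; J.-P. Serre, Invent. Math. 15 (1972), §2.4 Prop. 15
[Serre1972]; J. Balakrishnan, J. S. Müller, W. Stein, Math. Comp. 85 (2016), Thm. 1.7
[BalakrishnanMullerStein2015]; W. Stein, C. Wuthrich, Math. Comp. 82 (2013), Alg. 11.1 [SteinWuthrich2013].
-/

set_option autoImplicit false

-- single-conjunct summit: `Summit.BirchSwinnertonDyer.BirchSwinnertonDyer.…` repeats the name by design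
set_option linter.dupNamespace false

noncomputable section

open scoped Classical MatrixGroups ModularForm

open CongruenceSubgroup WeierstrassCurve Literature.NumberTheory.EllipticCurves
  Literature.NumberTheory.EllipticCurves.ModularForms
  Literature.NumberTheory.EllipticCurves.Rank1Residual
  Summit.BirchSwinnertonDyer.BirchSwinnertonDyer.Rank2Observatory
  Summit.BirchSwinnertonDyer.Rank1Residual.GaloisImage

namespace Summit.BirchSwinnertonDyer.BirchSwinnertonDyer.Rank2Sha

/-! ## §1. The Frobenius ORDER witness of `ρ̄_{E,3}` onto -/

namespace SurjWitness

variable (s : SurjWitness)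

/-- **Kernel test of the surj(3) witness** in the slots `(l₁, sq₁, n₁)` and `(l₂, sq₂, n₂)`: `ℓ₁, ℓ₂` odd
primes `≠ 3` of good reduction (`ℓ ∤ Δ`) with kernel point counts `curveCount ℓᵢ e = nᵢ`;
`t² − (ℓ₁ + 1 − n₁)t + ℓ₁ ≢ 0 (mod 3)` for `t < 3` (irreducible Frobenius); `ℓ₂ ≡ 1 (mod 3)`,
`ℓ₂ + 1 − n₂ ≡ 2 (mod 3)`, `9 ∤ n₂` (a Frobenius of order `3`). [cite: Serre1972, §2.4 Prop. 15 and §5.2 (iii)] -/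
def check₃ (e : WeierstrassCurve ℤ) : Bool :=
  Tam.TamLocal.primeB s.l₁ s.sq₁ && decide (s.l₁ ≠ 2) && decide (s.l₁ ≠ 3) &&
    decide (¬ ((s.l₁ : ℤ) ∣ e.Δ)) && decide (curveCount s.l₁ e = s.n₁) &&
    ((List.range 3).all fun t =>
      !decide ((3 : ℤ) ∣ (t : ℤ) ^ 2 - ((s.l₁ : ℤ) + 1 - s.n₁) * t + s.l₁)) &&
    Tam.TamLocal.primeB s.l₂ s.sq₂ && decide (s.l₂ ≠ 2) && decide (s.l₂ ≠ 3) &&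
    decide (¬ ((s.l₂ : ℤ) ∣ e.Δ)) && decide (curveCount s.l₂ e = s.n₂) &&
    decide (s.l₂ % 3 = 1) && decide ((3 : ℤ) ∣ (s.l₂ : ℤ) + 1 - s.n₂ - 2) && decide (¬ (9 ∣ s.n₂))

variable {s} {e : WeierstrassCurve ℤ}

/-- Unpacking a passing surj(3) witness check. [folklore] -/
theorem check₃_spec (h : s.check₃ e = true) :
    (s.l₁.Prime ∧ s.l₁ ≠ 2 ∧ s.l₁ ≠ 3 ∧ ¬ ((s.l₁ : ℤ) ∣ e.Δ) ∧ curveCount s.l₁ e = s.n₁ ∧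
      ∀ t : ℕ, t < 3 → ¬ ((3 : ℤ) ∣ (t : ℤ) ^ 2 - ((s.l₁ : ℤ) + 1 - s.n₁) * t + s.l₁)) ∧
    (s.l₂.Prime ∧ s.l₂ ≠ 2 ∧ s.l₂ ≠ 3 ∧ ¬ ((s.l₂ : ℤ) ∣ e.Δ) ∧ curveCount s.l₂ e = s.n₂ ∧
      s.l₂ % 3 = 1 ∧ (3 : ℤ) ∣ (s.l₂ : ℤ) + 1 - s.n₂ - 2 ∧ ¬ (9 ∣ s.n₂)) := by
  simp only [check₃, Bool.and_eq_true, decide_eq_true_eq, List.all_eq_true, List.mem_range,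
    Bool.not_eq_true', decide_eq_false_iff_not] at h
  obtain ⟨⟨⟨⟨⟨⟨⟨⟨⟨⟨⟨⟨⟨hP1, h21⟩, h31⟩, hΔ1⟩, hN1⟩, hall⟩, hP2⟩, h22⟩, h32⟩, hΔ2⟩, hN2⟩, hmod⟩,
    htr⟩, h9⟩ := h
  exact ⟨⟨Tam.TamLocal.prime_of_primeB hP1, h21, h31, hΔ1, hN1, hall⟩,
    ⟨Tam.TamLocal.prime_of_primeB hP2, h22, h32, hΔ2, hN2, hmod, htr, h9⟩⟩

/-- **`ρ̄_{E,3}` onto from the witness**: for `W/ℚ` globally minimal elliptic with integer model `e`, a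
passing `check₃` gives `Surj W 3` (the sibling cell's `hasSurjectiveModNGaloisRep_of_intModel_of_irr_of_order`
at `p = 3`, fed by the kernel point counts). [cite: Serre1972, §2.4 Prop. 15 and §5.2 (iii)]
[cite: SilvermanAEC2009, VII.3.1(b) and III.6.4(b)] -/
theorem surj_three_of_check₃ (h : s.check₃ e = true) (W : WeierstrassCurve ℚ) [W.IsElliptic]
    [W.IsGloballyMinimal] (hI : integralModelInt W = e) : W.HasSurjectiveModNGaloisRep 3 := by
  obtain ⟨⟨hP1, h21, h31, hΔ1, hN1, hall⟩, ⟨hP2, h22, h32, hΔ2, hN2, hmod, htr, h9⟩⟩ := check₃_spec h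
  haveI : Fact s.l₁.Prime := ⟨hP1⟩
  haveI : Fact s.l₂.Prime := ⟨hP2⟩
  have hc₁ : Nat.card ((e.map (Int.castRingHom (ZMod s.l₁))).toAffine.Point) = s.n₁ := by
    rw [card_eq_curveCount s.l₁ h21 e hΔ1, hN1]
  have hc₂ : Nat.card ((e.map (Int.castRingHom (ZMod s.l₂))).toAffine.Point) = s.n₂ := by
    rw [card_eq_curveCount s.l₂ h22 e hΔ2, hN2]
  refine hasSurjectiveModNGaloisRep_of_intModel_of_irr_of_order hI 3 s.l₁ s.l₂ h31 h32 hΔ1 hΔ2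
    hc₁ hc₂ (fun t ht => ?_) ?_ ?_ ?_
  · have hu := hall t.val (ZMod.val_lt t)
    apply hu
    show ((3 : ℕ) : ℤ) ∣ _
    rw [← ZMod.intCast_zmod_eq_zero_iff_dvd, ← ht]
    push_cast
    rw [ZMod.natCast_zmod_val]
  · rw [← ZMod.natCast_mod, hmod, Nat.cast_one]
  · have h0 : (((s.l₂ : ℤ) + 1 - s.n₂ - 2 : ℤ) : ZMod 3) = 0 :=
      (ZMod.intCast_zmod_eq_zero_iff_dvd _ 3).mpr htr
    push_cast at h0 ⊢
    linear_combination h0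
  · norm_num
    exact h9

end SurjWitness

/-! ## §2. The compact row at `p = 3` -/

namespace ShaRow

variable (R : ShaRow)

/-- **The BASE kernel test of a compact row at `p = 3`**: `R.p = 3`, `3 ∤ Δ`, `#Ẽ(𝔽₃) = 4 − a₃`, `3 ∤ a₃`
(good ORDINARY at `3`), a minimality criterion, and an EXACT Tamagawa row certificate. [folklore] -/
def check₃ : Bool :=
  decide (R.p = 3) && decide (¬ ((3 : ℤ) ∣ R.e.Δ)) &&
    decide ((curveCount 3 R.e : ℤ) = 3 + 1 - R.ap) && decide (¬ ((3 : ℤ) ∣ R.ap)) &&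
    (R.toAtlas.minCheck || R.toAtlas.minCheck₂ || R.toAtlas.minCheck₃) &&
    Tam.TamZ.rowCheckZ R.tam R.tamX R.tamZ R.e && Tam.TamZ.rowExactZ R.tam R.tamX R.tamZ

/-- **The kernel test of a `p = 3` row of frame «kato-bound»**: the base test AND the surj(3) witness.
[cite: Serre1972, §2.4 Prop. 15] -/
def checkK₃ : Bool := R.check₃ && R.sw.check₃ R.e

variable {R}

/-- A row passing `checkK₃` passes `check₃`. [folklore] -/
theorem check₃_of_checkK₃ (h : R.checkK₃ = true) : R.check₃ = true := by
  simp only [checkK₃, Bool.and_eq_true] at h; exact h.1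

/-- A row passing `checkK₃` has a passing surj(3) witness. [folklore] -/
theorem swcheck₃_of_checkK₃ (h : R.checkK₃ = true) : R.sw.check₃ R.e = true := by
  simp only [checkK₃, Bool.and_eq_true] at h; exact h.2

/-- From a tier theorem `rows.all checkK₃ = true` to the test of a member. [folklore] -/
theorem checkK₃_of_all {rows : List ShaRow} (hall : rows.all ShaRow.checkK₃ = true) {R : ShaRow}
    (hmem : R ∈ rows) : R.checkK₃ = true :=
  List.all_eq_true.mp hall R hmem

section Base

variable (h : R.check₃ = true)
include h

/-- Unpacking a passing `p = 3` base check. [folklore] -/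
theorem check₃_spec :
    R.p = 3 ∧ ¬ ((3 : ℤ) ∣ R.e.Δ) ∧ (curveCount 3 R.e : ℤ) = 3 + 1 - R.ap ∧ ¬ ((3 : ℤ) ∣ R.ap) ∧
      ((R.toAtlas.minCheck = true ∨ R.toAtlas.minCheck₂ = true) ∨ R.toAtlas.minCheck₃ = true) ∧
      Tam.TamZ.rowCheckZ R.tam R.tamX R.tamZ R.e = true ∧
      Tam.TamZ.rowExactZ R.tam R.tamX R.tamZ = true := by
  simp only [check₃, Bool.and_eq_true, Bool.or_eq_true, decide_eq_true_eq] at h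
  obtain ⟨⟨⟨⟨⟨⟨h3, hΔ⟩, hc⟩, hap⟩, hmin⟩, ht⟩, hx⟩ := h
  exact ⟨h3, hΔ, hc, hap, hmin, ht, hx⟩

/-- A `p = 3` row's prime field is `3`. [folklore] -/
theorem p_eq_three : R.p = 3 := (check₃_spec h).1

/-- A checking `p = 3` row's curve is elliptic (`Δ ≠ 0`, from `3 ∤ Δ`) AND its integer model is globally
minimal (finite criterion) — bundled (the two instances every `p = 3` row theorem needs).
[cite: SilvermanAEC2009, VII.1 Remark 1.1] -/
theorem isElliptic_and_isGloballyMinimal₃ :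
    (R.e.baseChange ℚ).IsElliptic ∧ (R.e.baseChange ℚ).IsGloballyMinimal := by
  refine ⟨Literature.NumberTheory.EllipticCurves.isElliptic_baseChange_int _ fun h0 =>
    (check₃_spec h).2.1 (by rw [h0]; exact dvd_zero _), ?_⟩
  rcases (check₃_spec h).2.2.2.2.1 with (h1 | h2) | h3
  · exact AtlasCurve.isGloballyMinimal h1
  · exact AtlasCurve.isGloballyMinimal₂ h2
  · exact AtlasCurve.isGloballyMinimal₃ h3

/-- A checking `p = 3` row is good ORDINARY at `3` (H1). [cite: SilvermanAEC2009, VII.1 Remark 1.1] -/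
theorem isOrdinaryAt₃ [(R.e.baseChange ℚ).IsGloballyMinimal] : IsOrdinaryAt (R.e.baseChange ℚ) 3 := by
  obtain ⟨-, hΔ, hc, hap, -⟩ := check₃_spec h
  refine isOrdinaryAt_baseChange_int_of_card 3 R.e hΔ (card_eq_curveCount 3 (by decide) R.e hΔ) ?_
  rw [hc]
  have : (3 : ℤ) + 1 - (3 + 1 - R.ap) = R.ap := by ring
  rw [show ((3 : ℕ) : ℤ) = 3 from rfl, this]
  exact hap

/-- At a checking `p = 3` row, the tree's `#Ẽ(𝔽₃)` is the kernel count `curveCount 3 e` AND the Tamagawa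
product IS the certificate's `rowValueZ` (H9) — bundled. [cite: SilvermanATAEC1994, IV.9.4] -/
theorem reductionPointCount_eq_and_tamagawaProduct_eq₃ [(R.e.baseChange ℚ).IsGloballyMinimal] :
    (R.e.baseChange ℚ).reductionPointCount 3 = curveCount 3 R.e ∧
      (R.e.baseChange ℚ).tamagawaProduct = Tam.TamZ.rowValueZ R.tam R.tamX R.tamZ := by
  obtain ⟨-, hΔ, -, -, -, ht, hx⟩ := check₃_spec h
  exact ⟨by rw [reductionPointCount_baseChange_int, card_eq_curveCount 3 (by decide) R.e hΔ],
    Tam.TamZ.tamagawaProduct_eqZ ht inferInstance hx⟩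

end Base

/-- At a row passing `checkK₃`, `ρ̄_{E,3}` is onto (H5 at `3`, Frobenius order witness).
[cite: Serre1972, §2.4 Prop. 15 and §5.2 (iii)] -/
theorem surj_of_checkK₃ (h : R.checkK₃ = true) [(R.e.baseChange ℚ).IsElliptic]
    [(R.e.baseChange ℚ).IsGloballyMinimal] : (R.e.baseChange ℚ).HasSurjectiveModNGaloisRep 3 :=
  SurjWitness.surj_three_of_check₃ (swcheck₃_of_checkK₃ h) _ (integralModelInt_baseChange_int R.e)

/-! ## §3. The row theorems at `p = 3` -/

/-- **TIER ROW THEOREM at `p = 3`, frame «kato-bound».** For a compact row `R` passing `checkK₃` (kernel: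
`p = 3` good ordinary, minimal model, exact Tamagawa certificate, `ρ̄_{E,3}` onto by the Frobenius order
witness), GIVEN `hS` (PRS, BMS Thm. 1.7), Kato's Thm. 17.4 for every cyclotomic datum (`hK`), the newform
`hf`, the rank certificate `hlow : 2 ≤ rank`, `hLp : [T²] L_3 ≠ 0`, `hcoeff : ord_3 [T²] L_3 = R.a`, THE
canonical `3`-adic height `Dh` with `hreg : ord_3 Reg_3 = R.b` — and Wuthrich's Lemma 20 supplied by the
tree's proof (`lemma20_surjective_threeAdic_of_semistable_holds`; `3` is a good prime): `rank_ℤ E(ℚ) = 2`,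
`Ш(E/ℚ)[3^∞]` finite, `Reg_3 ≠ 0`, `ord_3 #Ш(E/ℚ)[3^∞] ≤ R.k`. Per pair; NOT a class theorem.
[cite: Kato2004Asterisque, Thm. 17.4 (3) (p. 273) and (12.5.2) (p. 222)] [cite: Wuthrich2014, Lemma 20 (p. 399)]
[cite: BalakrishnanMullerStein2015, Thm. 1.7] [cite: SteinWuthrich2013, Alg. 11.1 and Prop. 11.2] -/
theorem kato₃ (h : R.checkK₃ = true) [(R.e.baseChange ℚ).IsElliptic] [(R.e.baseChange ℚ).IsGloballyMinimal]
    (hS : Schneider1985_order_charGenerator_odd) {N : ℕ} [NeZero N] {f : CuspForm (Gamma0 N) 2}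
    (hf : IsNewformOf (R.e.baseChange ℚ) f)
    (hK : ∀ (κ : ZpExtension ℚ 3) (γ : Field.absoluteGaloisGroup ℚ),
      kato_divisibility (R.e.baseChange ℚ) 3 (κ := κ) (γ := γ) (f := f))
    (hlow : 2 ≤ (R.e.baseChange ℚ).mordellWeilRank)
    (hLp : PowerSeries.coeff 2 (padicLFunction f (unitRoot (R.e.baseChange ℚ) 3 : ℚ_[3])) ≠ 0)
    (hcoeff : (PowerSeries.coeff 2
      (padicLFunction f (unitRoot (R.e.baseChange ℚ) 3 : ℚ_[3]))).valuation = R.a)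
    (Dh : PAdicHeightData (R.e.baseChange ℚ) 3) (hDh : Dh.IsCanonical)
    (hreg : (padicRegulator Dh).valuation = R.b) :
    (R.e.baseChange ℚ).mordellWeilRank = 2 ∧
      Finite (AddCommGroup.primaryComponent (R.e.baseChange ℚ).sha 3) ∧ SchneiderConjecture Dh ∧
      (padicValNat 3 (Nat.card (AddCommGroup.primaryComponent (R.e.baseChange ℚ).sha 3)) : ℤ) ≤ R.k := by
  have hb := check₃_of_checkK₃ h
  obtain ⟨hr, hfin, hSch, hle⟩ := card_shaPrimary_le_of_kato_certificate_three hS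
    Wuthrich2014.lemma20_surjective_threeAdic_of_semistable_holds (R.e.baseChange ℚ) f hK
    (isOrdinaryAt₃ hb) (surj_of_checkK₃ h) hf hlow hLp Dh hDh hcoeff hreg
  refine ⟨hr, hfin, hSch, ?_⟩
  rw [(reductionPointCount_eq_and_tamagawaProduct_eq₃ hb).1,
    (reductionPointCount_eq_and_tamagawaProduct_eq₃ hb).2] at hle
  rw [ShaRow.k, p_eq_three hb]
  push_cast at hle ⊢
  linarith

/-- **`p = 3`, frame «kato-bound», `R.k ≤ 0`: `Ш(E/ℚ)[3^∞] = 0` exactly.**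
[cite: SteinWuthrich2013, Thm. 1.1 and Alg. 11.1] [cite: Kato2004Asterisque, Thm. 17.4 (3) (p. 273)]
[cite: Wuthrich2014, Lemma 20 (p. 399)] -/
theorem kato₃_eq_one (h : R.checkK₃ = true) [(R.e.baseChange ℚ).IsElliptic]
    [(R.e.baseChange ℚ).IsGloballyMinimal]
    (hS : Schneider1985_order_charGenerator_odd) {N : ℕ} [NeZero N] {f : CuspForm (Gamma0 N) 2}
    (hf : IsNewformOf (R.e.baseChange ℚ) f)
    (hK : ∀ (κ : ZpExtension ℚ 3) (γ : Field.absoluteGaloisGroup ℚ),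
      kato_divisibility (R.e.baseChange ℚ) 3 (κ := κ) (γ := γ) (f := f))
    (hlow : 2 ≤ (R.e.baseChange ℚ).mordellWeilRank)
    (hLp : PowerSeries.coeff 2 (padicLFunction f (unitRoot (R.e.baseChange ℚ) 3 : ℚ_[3])) ≠ 0)
    (hcoeff : (PowerSeries.coeff 2
      (padicLFunction f (unitRoot (R.e.baseChange ℚ) 3 : ℚ_[3]))).valuation = R.a)
    (Dh : PAdicHeightData (R.e.baseChange ℚ) 3) (hDh : Dh.IsCanonical)
    (hreg : (padicRegulator Dh).valuation = R.b) (hk0 : R.k ≤ 0) :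
    (R.e.baseChange ℚ).mordellWeilRank = 2 ∧
      Finite (AddCommGroup.primaryComponent (R.e.baseChange ℚ).sha 3) ∧ SchneiderConjecture Dh ∧
      Nat.card (AddCommGroup.primaryComponent (R.e.baseChange ℚ).sha 3) = 1 := by
  obtain ⟨hr, hfin, hSch, hle⟩ := kato₃ h hS hf hK hlow hLp hcoeff Dh hDh hreg
  haveI := hfin
  have hv0 : padicValNat 3 (Nat.card (AddCommGroup.primaryComponent (R.e.baseChange ℚ).sha 3)) = 0 := by
    have := hle.trans hk0
    omega
  have hndvd : ¬ 3 ∣ Nat.card (AddCommGroup.primaryComponent (R.e.baseChange ℚ).sha 3) := by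
    rcases padicValNat.eq_zero_iff.mp hv0 with h1 | h0 | hnd
    · exact absurd h1 (by decide)
    · exact absurd h0 Nat.card_pos.ne'
    · exact hnd
  exact ⟨hr, hfin, hSch, natCard_primaryComponent_eq_one 3 hndvd⟩

/-! ## §4. Readers (instances built from the certificate inside the statement) -/

/-- **READER at `p = 3`, V-BOUND 0** («`Ш(E/ℚ)[3^∞] = 0`»): from the row certificate
`checkK₃ ∧ k ≤ 0 ∧ 2 ≤ rank`, GIVEN `hS`, the newform, Kato's Thm. 17.4 for every cyclotomic datum, the
L-datum and THE canonical `3`-adic height datum: `rank_ℤ E(ℚ) = 2`, `Ш(E/ℚ)[3^∞]` finite, `Reg_3 ≠ 0`,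
`#Ш(E/ℚ)[3^∞] = 1`. [cite: Kato2004Asterisque, Thm. 17.4 (3) (p. 273)] [cite: Wuthrich2014, Lemma 20 (p. 399)]
[cite: SteinWuthrich2013, Alg. 11.1 and Prop. 11.2] -/
theorem booked_katoOne₃ (h : R.checkK₃ = true ∧ R.k ≤ 0 ∧ 2 ≤ (R.e.baseChange ℚ).mordellWeilRank) :
    haveI := (isElliptic_and_isGloballyMinimal₃ (check₃_of_checkK₃ h.1)).1
    haveI := (isElliptic_and_isGloballyMinimal₃ (check₃_of_checkK₃ h.1)).2
    ∀ (_hS : Schneider1985_order_charGenerator_odd) {N : ℕ} [NeZero N] {f : CuspForm (Gamma0 N) 2}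
      (_hf : IsNewformOf (R.e.baseChange ℚ) f)
      (_hK : ∀ (κ : ZpExtension ℚ 3) (γ : Field.absoluteGaloisGroup ℚ),
        kato_divisibility (R.e.baseChange ℚ) 3 (κ := κ) (γ := γ) (f := f))
      (_hLp : PowerSeries.coeff 2 (padicLFunction f (unitRoot (R.e.baseChange ℚ) 3 : ℚ_[3])) ≠ 0)
      (_hcoeff : (PowerSeries.coeff 2
        (padicLFunction f (unitRoot (R.e.baseChange ℚ) 3 : ℚ_[3]))).valuation = R.a)
      (Dh : PAdicHeightData (R.e.baseChange ℚ) 3) (_hDh : Dh.IsCanonical)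
      (_hreg : (padicRegulator Dh).valuation = R.b),
      (R.e.baseChange ℚ).mordellWeilRank = 2 ∧
        Finite (AddCommGroup.primaryComponent (R.e.baseChange ℚ).sha 3) ∧ SchneiderConjecture Dh ∧
        Nat.card (AddCommGroup.primaryComponent (R.e.baseChange ℚ).sha 3) = 1 := by
  intro hS N _ f hf hK hLp hcoeff Dh hDh hreg
  haveI := (isElliptic_and_isGloballyMinimal₃ (check₃_of_checkK₃ h.1)).1
  haveI := (isElliptic_and_isGloballyMinimal₃ (check₃_of_checkK₃ h.1)).2
  exact kato₃_eq_one h.1 hS hf hK h.2.2 hLp hcoeff Dh hDh hreg h.2.1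

/-- **READER at `p = 3`, V-BOUND `b`**: from `checkK₃ ∧ 2 ≤ rank`: `rank = 2`, `Ш(E/ℚ)[3^∞]` finite,
`Reg_3 ≠ 0`, `ord_3 #Ш(E/ℚ)[3^∞] ≤ R.k`. [cite: Kato2004Asterisque, Thm. 17.4 (3) (p. 273)]
[cite: Wuthrich2014, Lemma 20 (p. 399)] [cite: SteinWuthrich2013, Alg. 11.1 and Prop. 11.2] -/
theorem booked_katoLe₃ (h : R.checkK₃ = true ∧ 2 ≤ (R.e.baseChange ℚ).mordellWeilRank) :
    haveI := (isElliptic_and_isGloballyMinimal₃ (check₃_of_checkK₃ h.1)).1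
    haveI := (isElliptic_and_isGloballyMinimal₃ (check₃_of_checkK₃ h.1)).2
    ∀ (_hS : Schneider1985_order_charGenerator_odd) {N : ℕ} [NeZero N] {f : CuspForm (Gamma0 N) 2}
      (_hf : IsNewformOf (R.e.baseChange ℚ) f)
      (_hK : ∀ (κ : ZpExtension ℚ 3) (γ : Field.absoluteGaloisGroup ℚ),
        kato_divisibility (R.e.baseChange ℚ) 3 (κ := κ) (γ := γ) (f := f))
      (_hLp : PowerSeries.coeff 2 (padicLFunction f (unitRoot (R.e.baseChange ℚ) 3 : ℚ_[3])) ≠ 0)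
      (_hcoeff : (PowerSeries.coeff 2
        (padicLFunction f (unitRoot (R.e.baseChange ℚ) 3 : ℚ_[3]))).valuation = R.a)
      (Dh : PAdicHeightData (R.e.baseChange ℚ) 3) (_hDh : Dh.IsCanonical)
      (_hreg : (padicRegulator Dh).valuation = R.b),
      (R.e.baseChange ℚ).mordellWeilRank = 2 ∧
        Finite (AddCommGroup.primaryComponent (R.e.baseChange ℚ).sha 3) ∧ SchneiderConjecture Dh ∧
        (padicValNat 3 (Nat.card (AddCommGroup.primaryComponent (R.e.baseChange ℚ).sha 3)) : ℤ) ≤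
          R.k := by
  intro hS N _ f hf hK hLp hcoeff Dh hDh hreg
  haveI := (isElliptic_and_isGloballyMinimal₃ (check₃_of_checkK₃ h.1)).1
  haveI := (isElliptic_and_isGloballyMinimal₃ (check₃_of_checkK₃ h.1)).2
  exact kato₃ h.1 hS hf hK h.2 hLp hcoeff Dh hDh hreg

end ShaRow

end Summit.BirchSwinnertonDyer.BirchSwinnertonDyer.Rank2Sha

end
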